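import Summits.QuantumFields.QCD.Theorems.HeatSlicedQuarksSmallFieldUltracontractivityStubFreeKernelDecay
import Summits.QuantumFields.QCD.Theorems.HeatSlicedQuarksSmallFieldUltracontractivityStubFreeKernelFourier
import Summits.QuantumFields.QCD.Theorems.HeatSlicedQuarksSmallFieldUltracontractivityFixedPointD1

/-!
# Stub `stub_freeColumnProfile` of line `Sketch`
(crux `Summit.QuantumFields.QCD.Theses.HeatSlicedQuarks.InterleavedHeatSliceFlow`, item stmt-QuantumFields-8891)

**FreeColumnProfile** (reshape r4, an input of `stub_columnIdentification`).  Let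
`D₁ = wilsonDirac ρ 1 m 1` be the FREE massive `r = 1` Wilson–Dirac matrix on the discrete four-torus
`T_L` (all links `= 1`) and `K = e^{-σ D₁ᴴ D₁}` its heat kernel.  For `m ∈ [-1/2, 1]`, `0 ≤ σ ≤ L²`,
with `d = torusDist x z`:

* `|K((z,b,β),(x,a,α))| ≤ C e^{-cσm²} (1+σ)/(1+σ+d²)³` (the column through `(x,a,α)`);
* `|(D₁ K)((z,b,β),(x,a,α))| ≤ C e^{-cσm²} √(1+σ)/(1+σ+d²)³`.

Proof.  Both are corollaries of the landed decay theorem `stub_freeKernelDecay stub_freeKernelFourier`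
of crux 8871 (entries `≤ C₀ e^{-c₀σm²}(1+σ)/(1+σ+d²)³` and nearest-neighbour differences IN THE SECOND
INDEX `≤ C₀ e^{-c₀σm²}√(1+σ)/(1+σ+d²)³`).  The first item is that theorem read at `((z,b,β),(x,a,α))`
together with `torusDist z x = torusDist x z`.  For the second, `(D₁ K)(q,p) = (D₁ (K · p))(q)` and the
free apply formula `norm_wilsonDirac_freeCfg_mulVec_apply_le` (module `…FixedPointD1`) bounds it by
`|m| |K(z,p)| + Σ_μ Σ_β' (|K((z,b,β'),p) − K((z+μ̂,b,β'),p)| + |K((z,b,β'),p) − K((z−μ̂,b,β'),p)|)`.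
Since `K` is Hermitian (`isHermitian_exp_neg_smul`), first-index differences of a column are (conjugates
of) second-index differences of a row, so each of the `2·16` difference terms is bounded by the landed
difference decay — the backward ones at the shifted site `z − μ̂`, at torus distance `≥ d − 1` from `x`,
which costs the factor `27` from `1+σ+d² ≤ 3(1+σ+(d−1)²)`.  The mass term carries `(1+σ)` instead of
`√(1+σ)`; it is absorbed by halving the Gaussian rate: `|m| √(1+σ) e^{-(c₀/2)σm²} ≤ 1 + 1/c₀`.
Output constants: `C = C₀ (449 + 1/c₀)`, `c = c₀/2`.  No unproved facts are used.
-/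

noncomputable section

namespace Summit.QuantumFields.QCD.Cruxes.InterleavedHeatSliceFlow.Sketch

open Literature.MathematicalPhysics.QuantumLattice Literature.MathematicalPhysics.QuantumFieldTheory
  Literature.Probability.LatticeModels
open Summit.QuantumFields.QCD.Theses.HeatSlicedQuarks
open Summit.QuantumFields.QCD.Theorems.SmallFieldUltracontractivity.Negative
open Summit.QuantumFields.QCD.Cruxes.SmallFieldUltracontractivity.PointCentredAxialParabolic
open Summit.QuantumFields.QCD.Theorems.HeatSlicedQuarksDaviesGaffney (torusDist_self_shift_le)
open scoped Matrix

/-- For a Hermitian matrix, a first-index difference of a column has the norm of the corresponding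
second-index difference of a row: `‖A j i − A j' i‖ = ‖A i j − A i j'‖`. -/
private theorem norm_sub_of_isHermitian {ι : Type*} {A : Matrix ι ι ℂ} (hA : A.IsHermitian)
    (i j j' : ι) : ‖A j i - A j' i‖ = ‖A i j - A i j'‖ := by
  rw [← hA.apply j i, ← hA.apply j' i, ← star_sub, norm_star]

/-- Moving the far site by one lattice step costs at most a factor `27` in the profile
`(1+σ+d²)⁻³`: if `d ≤ d' + 1` then `X/(1+σ+d'²)³ ≤ 27 X/(1+σ+d²)³` for `X, σ ≥ 0`. -/
private theorem profile_shift_le {σ X : ℝ} (hσ : 0 ≤ σ) (hX : 0 ≤ X) {d d' : ℕ} (hd : d ≤ d' + 1) :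
    X / (1 + σ + (d' : ℝ) ^ 2) ^ 3 ≤ 27 * (X / (1 + σ + (d : ℝ) ^ 2) ^ 3) := by
  have hd' : (d : ℝ) ≤ d' + 1 := by exact_mod_cast hd
  have hd0 : (0 : ℝ) ≤ d := Nat.cast_nonneg d
  have hd'0 : (0 : ℝ) ≤ d' := Nat.cast_nonneg d'
  have hP : 0 < 1 + σ + (d : ℝ) ^ 2 := by positivity
  have hP' : 0 < 1 + σ + (d' : ℝ) ^ 2 := by positivity
  have hle : 1 + σ + (d : ℝ) ^ 2 ≤ 3 * (1 + σ + (d' : ℝ) ^ 2) := by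
    nlinarith [mul_le_mul hd' hd' hd0 (by linarith), sq_nonneg ((d' : ℝ) - 1)]
  have h3 : (1 + σ + (d : ℝ) ^ 2) ^ 3 / 27 ≤ (1 + σ + (d' : ℝ) ^ 2) ^ 3 := by
    have := pow_le_pow_left₀ hP.le hle 3
    rw [mul_pow] at this
    linarith [this]
  have h27 : 27 * (X / (1 + σ + (d : ℝ) ^ 2) ^ 3) = X / ((1 + σ + (d : ℝ) ^ 2) ^ 3 / 27) := by
    rw [div_div_eq_mul_div]
    ring
  rw [h27]
  exact div_le_div_of_nonneg_left hX (by positivity) h3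

/-- The mass factor against half of the Gaussian: `|m| √(1+σ) e^{-(c/2)σm²} ≤ 1 + 1/c` for `m² ≤ 1`,
`σ ≥ 0`, `c > 0` (square it: `c m²(1+σ) e^{-cσm²} ≤ c + (cσm²) e^{-cσm²} ≤ c + 1`). -/
private theorem mass_weight_le {c σ m : ℝ} (hc : 0 < c) (hσ : 0 ≤ σ) (hm : m ^ 2 ≤ 1) :
    |m| * Real.sqrt (1 + σ) * Real.exp (-(c / 2 * σ * m ^ 2)) ≤ 1 + 1 / c := by
  set X := |m| * Real.sqrt (1 + σ) * Real.exp (-(c / 2 * σ * m ^ 2)) with hX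
  have hX0 : 0 ≤ X := by positivity
  have hE : Real.exp (-(c / 2 * σ * m ^ 2)) ^ 2 = Real.exp (-(c * σ * m ^ 2)) := by
    rw [← Real.exp_nat_mul]
    congr 1
    push_cast
    ring
  have hX2 : X ^ 2 = m ^ 2 * (1 + σ) * Real.exp (-(c * σ * m ^ 2)) := by
    rw [hX, mul_pow, mul_pow, sq_abs, Real.sq_sqrt (by linarith), hE]
  have hE0 : 0 < Real.exp (-(c * σ * m ^ 2)) := Real.exp_pos _
  have hE1 : Real.exp (-(c * σ * m ^ 2)) ≤ 1 :=
    Real.exp_le_one_iff.2 (by nlinarith [sq_nonneg m, mul_nonneg hc.le hσ])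
  -- `e^{-cσm²} (1 + cσm²) ≤ 1`
  have hexp : Real.exp (-(c * σ * m ^ 2)) * (1 + c * σ * m ^ 2) ≤ 1 := by
    have h1 := Real.add_one_le_exp (c * σ * m ^ 2)
    have h2 : Real.exp (-(c * σ * m ^ 2)) * Real.exp (c * σ * m ^ 2) = 1 := by
      rw [← Real.exp_add, neg_add_cancel, Real.exp_zero]
    calc Real.exp (-(c * σ * m ^ 2)) * (1 + c * σ * m ^ 2)
        ≤ Real.exp (-(c * σ * m ^ 2)) * Real.exp (c * σ * m ^ 2) :=
          mul_le_mul_of_nonneg_left (by linarith) hE0.le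
      _ = 1 := h2
  have hcX2 : c * X ^ 2 ≤ c + 1 := by
    rw [hX2]
    have h1 : m ^ 2 * Real.exp (-(c * σ * m ^ 2)) ≤ 1 := by
      calc m ^ 2 * Real.exp (-(c * σ * m ^ 2)) ≤ 1 * 1 := mul_le_mul hm hE1 hE0.le zero_le_one
        _ = 1 := one_mul 1
    have h2 : c * σ * m ^ 2 * Real.exp (-(c * σ * m ^ 2)) ≤ 1 := by nlinarith [hexp, hE0]
    calc c * (m ^ 2 * (1 + σ) * Real.exp (-(c * σ * m ^ 2)))
        = c * (m ^ 2 * Real.exp (-(c * σ * m ^ 2))) + c * σ * m ^ 2 * Real.exp (-(c * σ * m ^ 2)) := by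
          ring
      _ ≤ c * 1 + 1 := add_le_add (mul_le_mul_of_nonneg_left h1 hc.le) h2
      _ = c + 1 := by ring
  have hcX : c * X ≤ c + 1 := by
    have h1 : (c * X) ^ 2 ≤ (c + 1) ^ 2 := by
      calc (c * X) ^ 2 = c * (c * X ^ 2) := by ring
        _ ≤ c * (c + 1) := mul_le_mul_of_nonneg_left hcX2 hc.le
        _ ≤ (c + 1) ^ 2 := by nlinarith
    exact (sq_le_sq₀ (by positivity) (by positivity)).1 h1
  rw [show 1 + 1 / c = (c + 1) / c by field_simp, le_div_iff₀ hc]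
  linarith

/-- **FreeColumnProfile** (registered stub `stub_freeColumnProfile` of line `Sketch`, reshape r4, input of
`stub_columnIdentification`): entrywise decay of the free Wilson heat-kernel column
`e^{-σD₁ᴴD₁}(·,(x,a,α))` — profile `(1+σ)/(1+σ+d²)³` — and of its image under the free Wilson–Dirac matrix
`D₁ · e^{-σD₁ᴴD₁}(·,(x,a,α))` — profile `√(1+σ)/(1+σ+d²)³` — both with the mass factor `e^{-cσm²}`, for
`m ∈ [-1/2,1]`, `0 ≤ σ ≤ L²`.  From crux 8871's `stub_freeKernelDecay stub_freeKernelFourier` (entries and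
second-index differences), Hermitian symmetry of the heat kernel, the free apply formula
`norm_wilsonDirac_freeCfg_mulVec_apply_le`, the one-step profile shift (factor `27`) and
`|m|√(1+σ) e^{-(c/2)σm²} ≤ 1 + 1/c`. -/
theorem stub_freeColumnProfile :
    ∃ C c : ℝ, 0 < c ∧ ∀ (L : ℕ) [NeZero L] (m : ℝ), m ∈ Set.Icc (-(1 / 2 : ℝ)) 1 →
      ∀ σ : ℝ, 0 ≤ σ → σ ≤ (L : ℝ) ^ 2 → ∀ (x z : TorusSite 4 L) (a b : Fin 3) (α β : Fin 4),
        ‖(NormedSpace.exp (-(σ : ℂ) •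
            ((wilsonDirac (fundamentalRep (Fin 3))
                (fun _ : Edge 4 L => (1 : Matrix.specialUnitaryGroup (Fin 3) ℂ)) m 1)ᴴ *
              wilsonDirac (fundamentalRep (Fin 3))
                (fun _ : Edge 4 L => (1 : Matrix.specialUnitaryGroup (Fin 3) ℂ)) m 1))) (z, b, β) (x, a, α)‖ ≤
            C * Real.exp (-(c * σ * m ^ 2)) * (1 + σ) / (1 + σ + (torusDist x z : ℝ) ^ 2) ^ 3 ∧
        ‖(wilsonDirac (fundamentalRep (Fin 3))
              (fun _ : Edge 4 L => (1 : Matrix.specialUnitaryGroup (Fin 3) ℂ)) m 1 *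
            NormedSpace.exp (-(σ : ℂ) •
              ((wilsonDirac (fundamentalRep (Fin 3))
                  (fun _ : Edge 4 L => (1 : Matrix.specialUnitaryGroup (Fin 3) ℂ)) m 1)ᴴ *
                wilsonDirac (fundamentalRep (Fin 3))
                  (fun _ : Edge 4 L => (1 : Matrix.specialUnitaryGroup (Fin 3) ℂ)) m 1))) (z, b, β) (x, a, α)‖ ≤
            C * Real.exp (-(c * σ * m ^ 2)) * Real.sqrt (1 + σ) / (1 + σ + (torusDist x z : ℝ) ^ 2) ^ 3 := by
  obtain ⟨C, c, hc, h⟩ := stub_freeKernelDecay stub_freeKernelFourier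
  refine ⟨C * (449 + 1 / c), c / 2, half_pos hc, ?_⟩
  intro L _ m hm σ hσ hσL x z a b α β
  show ‖(NormedSpace.exp (-(σ : ℂ) • ((wilsonDirac (fundamentalRep (Fin 3)) (freeCfg L) m 1)ᴴ *
      wilsonDirac (fundamentalRep (Fin 3)) (freeCfg L) m 1))) (z, b, β) (x, a, α)‖ ≤ _ ∧
    ‖(wilsonDirac (fundamentalRep (Fin 3)) (freeCfg L) m 1 *
      NormedSpace.exp (-(σ : ℂ) • ((wilsonDirac (fundamentalRep (Fin 3)) (freeCfg L) m 1)ᴴ *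
        wilsonDirac (fundamentalRep (Fin 3)) (freeCfg L) m 1))) (z, b, β) (x, a, α)‖ ≤ _
  set D : Matrix (TorusSite 4 L × Fin 3 × Fin 4) (TorusSite 4 L × Fin 3 × Fin 4) ℂ :=
    wilsonDirac (fundamentalRep (Fin 3)) (freeCfg L) m 1 with hD
  set K : Matrix (TorusSite 4 L × Fin 3 × Fin 4) (TorusSite 4 L × Fin 3 × Fin 4) ℂ :=
    NormedSpace.exp (-(σ : ℂ) • (Dᴴ * D)) with hK
  have hH : K.IsHermitian := isHermitian_exp_neg_smul D σ
  have hrow := h L m hm σ hσ hσL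
  -- abbreviations and signs
  set E : ℝ := Real.exp (-(c * σ * m ^ 2)) with hE
  set E' : ℝ := Real.exp (-(c / 2 * σ * m ^ 2)) with hE'
  set S : ℝ := Real.sqrt (1 + σ) with hS
  set P : ℝ := 1 + σ + ((torusDist x z : ℕ) : ℝ) ^ 2 with hP
  have h1σ : 0 < 1 + σ := by linarith
  have hP0 : 0 < P := by positivity
  have hE0 : 0 < E := Real.exp_pos _
  have hE'0 : 0 < E' := Real.exp_pos _
  have hS0 : 0 ≤ S := Real.sqrt_nonneg _
  have hS2 : S * S = 1 + σ := Real.mul_self_sqrt h1σ.le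
  have hEE' : E ≤ E' := Real.exp_le_exp.2 (by nlinarith [sq_nonneg m, mul_nonneg hc.le hσ])
  have hEsq : E = E' * E' := by
    rw [hE, hE', ← Real.exp_add]
    congr 1
    ring
  have hm2 : m ^ 2 ≤ 1 := by
    obtain ⟨hm1, hm2⟩ := hm
    nlinarith
  -- the entry bound for the column through `(x,a,α)`
  have hent : ‖K (z, b, β) (x, a, α)‖ ≤ C * E * (1 + σ) / P ^ 3 := by
    have h1 := (hrow z x b a β α).1
    rwa [torusDist_comm'] at h1
  have hC : 0 ≤ C := by
    have h1 := (norm_nonneg _).trans hent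
    rw [le_div_iff₀ (pow_pos hP0 3), zero_mul] at h1
    nlinarith [h1, mul_pos hE0 h1σ]
  have hc1 : (1 : ℝ) ≤ 449 + 1 / c := by
    have : 0 < 1 / c := by positivity
    linarith
  -- forward differences of the column
  have hfwd : ∀ (μ : Fin 4) (β' : Fin 4),
      ‖K (z, b, β') (x, a, α) - K (z + Pi.single μ 1, b, β') (x, a, α)‖ ≤ C * E * S / P ^ 3 := by
    intro μ β'
    rw [norm_sub_of_isHermitian hH]
    exact (hrow x z a b α β').2 μ
  -- backward differences of the column
  have hbwd : ∀ (μ : Fin 4) (β' : Fin 4),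
      ‖K (z, b, β') (x, a, α) - K (z - Pi.single μ 1, b, β') (x, a, α)‖ ≤ 27 * (C * E * S / P ^ 3) := by
    intro μ β'
    rw [norm_sub_of_isHermitian hH, norm_sub_rev]
    have hshift : Site.shift (z - Pi.single μ 1) μ = z := sub_add_cancel z (Pi.single μ 1)
    have h1 := (hrow x (z - Pi.single μ 1) a b α β').2 μ
    rw [hshift] at h1
    refine h1.trans ?_
    have hd : torusDist x z ≤ torusDist x (z - Pi.single μ 1) + 1 := by
      have h2 : torusDist (z - Pi.single μ 1) z ≤ 1 := by
        have h3 := torusDist_self_shift_le (z - Pi.single μ 1) μ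
        rwa [hshift] at h3
      calc torusDist x z ≤ torusDist x (z - Pi.single μ 1) + torusDist (z - Pi.single μ 1) z :=
            torusDist_triangle' _ _ _
        _ ≤ torusDist x (z - Pi.single μ 1) + 1 := Nat.add_le_add_left h2 _
    exact profile_shift_le hσ (by positivity) hd
  constructor
  · -- part 1: the entries
    refine hent.trans (div_le_div_of_nonneg_right ?_ (pow_pos hP0 3).le)
    have h1 : C * E ≤ C * (449 + 1 / c) * E' := by
      calc C * E = C * 1 * E := by ring
        _ ≤ C * (449 + 1 / c) * E' := by gcongr
    exact mul_le_mul_of_nonneg_right h1 h1σ.le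
  · -- part 2: the image under `D₁`
    have happly : (D * K) (z, b, β) (x, a, α) = (D *ᵥ fun q => K q (x, a, α)) (z, b, β) := rfl
    rw [happly]
    refine (norm_wilsonDirac_freeCfg_mulVec_apply_le m (fun q => K q (x, a, α)) z b β).trans ?_
    have hmass : |m| * ‖K (z, b, β) (x, a, α)‖ ≤ C * (1 + 1 / c) * E' * S / P ^ 3 := by
      calc |m| * ‖K (z, b, β) (x, a, α)‖ ≤ |m| * (C * E * (1 + σ) / P ^ 3) :=
            mul_le_mul_of_nonneg_left hent (abs_nonneg m)
        _ = C * (|m| * S * E') * E' * S / P ^ 3 := by rw [hEsq, ← hS2]; ring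
        _ ≤ C * (1 + 1 / c) * E' * S / P ^ 3 := by
            gcongr
            exact mass_weight_le hc hσ hm2
    have hdiff : ∑ μ : Fin 4, ∑ β' : Fin 4,
        (‖K (z, b, β') (x, a, α) - K (z + Pi.single μ 1, b, β') (x, a, α)‖ +
          ‖K (z, b, β') (x, a, α) - K (z - Pi.single μ 1, b, β') (x, a, α)‖) ≤ 448 * (C * E * S / P ^ 3) := by
      calc ∑ μ : Fin 4, ∑ β' : Fin 4,
            (‖K (z, b, β') (x, a, α) - K (z + Pi.single μ 1, b, β') (x, a, α)‖ +
              ‖K (z, b, β') (x, a, α) - K (z - Pi.single μ 1, b, β') (x, a, α)‖)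
          ≤ ∑ _μ : Fin 4, ∑ _β' : Fin 4, (C * E * S / P ^ 3 + 27 * (C * E * S / P ^ 3)) :=
            Finset.sum_le_sum fun μ _ => Finset.sum_le_sum fun β' _ => add_le_add (hfwd μ β') (hbwd μ β')
        _ = 448 * (C * E * S / P ^ 3) := by
            simp only [Finset.sum_const, Finset.card_univ, Fintype.card_fin, nsmul_eq_mul]
            push_cast
            ring
    calc |m| * ‖K (z, b, β) (x, a, α)‖ + ∑ μ : Fin 4, ∑ β' : Fin 4,
          (‖K (z, b, β') (x, a, α) - K (z + Pi.single μ 1, b, β') (x, a, α)‖ +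
            ‖K (z, b, β') (x, a, α) - K (z - Pi.single μ 1, b, β') (x, a, α)‖)
        ≤ C * (1 + 1 / c) * E' * S / P ^ 3 + 448 * (C * E * S / P ^ 3) := add_le_add hmass hdiff
      _ ≤ C * (1 + 1 / c) * E' * S / P ^ 3 + 448 * (C * E' * S / P ^ 3) := by gcongr
      _ = C * (449 + 1 / c) * E' * S / P ^ 3 := by ring

end Summit.QuantumFields.QCD.Cruxes.InterleavedHeatSliceFlow.Sketch

end
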